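import Summits.QuantumAdvantage.QuantumAdvantage.Theorems.CubicForrelationNearExactIsExactBentLOne
import Summits.QuantumAdvantage.QuantumAdvantage.Theorems.CubicForrelationNearExactIsExactFourteenSecondBent

/-!
# Crux `CubicForrelation.NearExactIsExact` (stmt-QuantumAdvantage-14043) — the bent-side LADDER on 4-flats inside the prefix flat, `n = 14`
  (Kasami–Tokura line `|S| = 768`, `Φ = 29/32`: for every 4-flat `G` inside `U = {P₀ = P₁ = P₂ = 1}`,
  `Σ_{x ∈ G, Q(x) = 1} (−1)^{f(x)} ≡ 0 (mod 4)`)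

Certificate seat `b2b-cforr-cert` (gen 44).  HONEST FRAMING: one kernel-checked LEMMA (standard axioms) of the bent-side analysis at
`n = 14` — step (T1) of DISPROOF.md §18.2/18.6(a) for the only window-relevant Kasami–Tokura line `Φ = 29/32`, on top of the normal form
`f ⊕ g̃ = (A₀A₁ ⊕ A₂A₃) ∧ P₀P₁P₂` now provided by `kh_structure_rm5_fourteen_768` (…KtHalfStructure).  NOT summit progress; no value
of `θ₁₄` is claimed (the remaining steps — the cubic-in-support lemma on `U`, the plateau `{0, ±512}` of the partial transform and the
`L¹` contradiction with `kb_bent_gap_bound` — are listed in HOME/b2b-cforr-cert-g44/LEAN-GEN44.md).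

`kb_ladder_four`: let `f, g` be cubic on `14` bits, `W_g = 2⁷(−1)^d` (so `g` is bent with dual `d`), and suppose `f ⊕ d = Q ∧ P₀P₁P₂`
pointwise with `Q = A₀A₁ ⊕ A₂A₃` and `P₀, P₁, P₂` flipped by `u₀, u₁, u₂` respectively (each `u_k` fixing the other `P`'s).  Then for every
base point `q` with `P(q) = 1` and every four directions `a₀,…,a₃` fixing `P₀, P₁, P₂` (the parametrised 4-flat `q ⊕ ⟨a⟩` lies inside
`U`; no independence is assumed), `4 ∣ Σ_{ε ∈ 𝔽₂⁴} [Q(q ⊕ a_ε)]·(−1)^{f(q ⊕ a_ε)}`.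
Proof: the two-sided congruence on the parametrised 7-flat `q ⊕ ⟨u₀,u₁,u₂,a₀,…,a₃⟩` — `Σ W_g/32 ≡ 0 (mod 32)` (`fs_flat_sum_dvd`, Ax on the
annihilator) and `Σ 4(−1)^f ≡ 0 (mod 32)` (`sl_sum_sZ_flat`, Ax on `f`), so `τ = W_g/32 − 4(−1)^f = −8(−1)^f·1_S` sums to `0 (mod 32)` —
followed by peeling the three transversal directions `u_k` (`fr_sum_peel`): the peeled points leave `U`, where `τ = 0`.

References: J. Ax (1964) / R. J. McEliece (1972); T. Kasami, N. Tokura (1970) Thm 1; DISPROOF.md §18.  Axioms: the standard three.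
-/

set_option linter.dupNamespace false -- D-0017: single-problem summit ⇒ `QuantumAdvantage.QuantumAdvantage` by design

noncomputable section

namespace Summit.QuantumAdvantage.QuantumAdvantage.Theorems.CubicForrelation.NearExactIsExact

open Finset
open Literature.Computability.QuantumComplexity
open Literature.Computability.QuantumComplexity.BuzetChailloux (bxor zeroVec bxor_self bxor_zeroVec zeroVec_bxor bxor_comm
  bxor_bxor_cancel_left)
open Literature.Computability.QuantumComplexity.DerivativeWalsh (W)

/-- **The ladder on 4-flats inside the prefix flat (`n = 14`, line `|S| = 768`).**  See the module header.
[this work; cite: KasamiTokura1970, Thm 1] -/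
theorem kb_ladder_four (f g d : (Fin (7 + 7) → Bool) → Bool) (hf : IsDegLeFun 3 f) (hg : IsDegLeFun 3 g)
    (hd : ∀ x, W (fun y => signOf (g y)) x = (2 : ℝ) ^ 7 * signOf (d x))
    (A : Fin 4 → (Fin (7 + 7) → Bool) → Bool) (P : Fin 3 → (Fin (7 + 7) → Bool) → Bool) (u : Fin 3 → Fin (7 + 7) → Bool)
    (hPu : ∀ j x, P j (bxor x (u j)) = !P j x) (hPu' : ∀ j k x, j ≠ k → P j (bxor x (u k)) = P j x)
    (hnf : ∀ x, (f x ^^ d x) = (((A 0 x && A 1 x) ^^ (A 2 x && A 3 x)) && decide (∀ j, P j x = true)))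
    (q : Fin (7 + 7) → Bool) (hq : ∀ j, P j q = true)
    (a : Fin 4 → Fin (7 + 7) → Bool) (ha : ∀ i j x, P j (bxor x (a i)) = P j x) :
    (4 : ℤ) ∣ ∑ ε : Fin 4 → Bool,
      (if ((A 0 (fun l => q l ^^ decide (Odd #(univ.filter fun i => ε i && a i l))) &&
            A 1 (fun l => q l ^^ decide (Odd #(univ.filter fun i => ε i && a i l)))) ^^
           (A 2 (fun l => q l ^^ decide (Odd #(univ.filter fun i => ε i && a i l))) &&
            A 3 (fun l => q l ^^ decide (Odd #(univ.filter fun i => ε i && a i l))))) = true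
        then sZ (f (fun l => q l ^^ decide (Odd #(univ.filter fun i => ε i && a i l)))) else 0) := by
  classical
  -- the residual `τ = W_g/32 − 4(−1)^f`
  set ug : (Fin (7 + 7) → Bool) → ℤ := fun x => 4 * sZ (d x) with hug
  have hu : ∀ x, W (fun y => signOf (g y)) x = (2 : ℝ) ^ 5 * (ug x : ℝ) := by
    intro x; rw [hd x]; simp only [ug]; push_cast; rw [tp_sZ_cast]; ring
  set τ : (Fin (7 + 7) → Bool) → ℤ := fun x => ug x - 4 * sZ (f x) with hτ
  have hτ0 : ∀ z j, P j z = false → τ z = 0 := by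
    intro z j hz
    have h := hnf z
    have hdec : decide (∀ j, P j z = true) = false := by
      rw [decide_eq_false_iff_not]; intro hall; rw [hall j] at hz; exact Bool.noConfusion hz
    rw [hdec, Bool.and_false] at h
    have : f z = d z := by revert h; cases f z <;> cases d z <;> decide
    simp only [τ, ug]; rw [this]; ring
  have hτS : ∀ z, (∀ j, P j z = true) →
      τ z = (if ((A 0 z && A 1 z) ^^ (A 2 z && A 3 z)) = true then -8 * sZ (f z) else 0) := by
    intro z hz
    have h := hnf z
    rw [decide_eq_true hz, Bool.and_true] at h
    simp only [τ, ug]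
    by_cases hQ : ((A 0 z && A 1 z) ^^ (A 2 z && A 3 z)) = true
    · rw [if_pos hQ]
      rw [hQ] at h
      have : d z = !f z := by revert h; cases f z <;> cases d z <;> decide
      rw [this]; cases f z <;> simp [sZ]
    · rw [if_neg hQ]
      have hQ' : ((A 0 z && A 1 z) ^^ (A 2 z && A 3 z)) = false := by simpa using hQ
      rw [hQ'] at h
      have : f z = d z := by revert h; cases f z <;> cases d z <;> decide
      rw [this]; ring
  -- the 7-flat congruence
  have h32 : ∀ (b : Fin (7 + 7) → Bool) (c : Fin 7 → Fin (7 + 7) → Bool),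
      (32 : ℤ) ∣ ∑ ε : Fin 7 → Bool, τ (fun j => b j ^^ decide (Odd #(univ.filter fun i => ε i && c i j))) := by
    intro b c
    have h1 := fs_flat_sum_dvd (e := 5) g ug hg hu b c (by norm_num)
    obtain ⟨zf, hzf⟩ := sl_sum_sZ_flat f hf b c
    have h2 : ∑ ε : Fin 7 → Bool, τ (fun j => b j ^^ decide (Odd #(univ.filter fun i => ε i && c i j))) =
        ∑ ε : Fin 7 → Bool, ug (fun j => b j ^^ decide (Odd #(univ.filter fun i => ε i && c i j))) -
        4 * ∑ ε : Fin 7 → Bool, sZ (f (fun j => b j ^^ decide (Odd #(univ.filter fun i => ε i && c i j)))) := by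
      simp only [τ]; rw [sum_sub_distrib, mul_sum]
    rw [h2, hzf]
    norm_num at h1 ⊢
    exact dvd_sub h1 (Dvd.intro _ (by ring))
  -- peeling one transversal direction `u k`: the peeled points leave `{P k = 1}`
  have hpeel : ∀ (k : Fin 3) {m : ℕ} (c : Fin m → Fin (7 + 7) → Bool), (∀ i x, P k (bxor x (c i)) = P k x) →
      ∑ ε : Fin (m + 1) → Bool, τ (fun j => q j ^^ decide (Odd #(univ.filter fun i =>
          ε i && (Matrix.vecCons (u k) c : Fin (m + 1) → Fin (7 + 7) → Bool) i j))) =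
        ∑ ε : Fin m → Bool, τ (fun j => q j ^^ decide (Odd #(univ.filter fun i => ε i && c i j))) := by
    intro k m c hc
    rw [fr_sum_peel τ q (u k) c]
    have hz : ∑ ε : Fin m → Bool, τ (bxor (fun j => q j ^^ decide (Odd #(univ.filter fun i => ε i && c i j))) (u k)) = 0 := by
      refine sum_eq_zero fun ε _ => hτ0 _ k ?_
      set V₀ := univ.filter (fun t : Fin (7 + 7) → Bool => ∀ x, P k (bxor x t) = P k x) with hV₀
      have h0 : zeroVec ∈ V₀ := mem_filter.2 ⟨mem_univ _, fun x => by rw [bxor_zeroVec]⟩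
      have hpt : P k (fun j => q j ^^ decide (Odd #(univ.filter fun i => ε i && c i j))) = true :=
        fo_mem_flatPt V₀ h0 (fun x => P k x = true) (fun x hx t ht => by rw [(mem_filter.1 ht).2 x]; exact hx)
          (hq k) c (fun i => mem_filter.2 ⟨mem_univ _, hc i⟩) ε
      rw [hPu, hpt]; rfl
    rw [hz, add_zero]
  -- three peelings: from the 7-flat `q ⊕ ⟨u₀, u₁, u₂, a⟩` down to the 4-flat `q ⊕ ⟨a⟩`
  have hc1 : ∀ (i : Fin 5) x, P 1 (bxor x ((Matrix.vecCons (u 2) a : Fin 5 → Fin (7 + 7) → Bool) i)) = P 1 x := by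
    intro i x
    refine Fin.cases ?_ (fun i => ?_) i
    · simp only [Matrix.cons_val_zero]; exact hPu' 1 2 x (by decide)
    · simp only [Matrix.cons_val_succ]; exact ha i 1 x
  have hc0 : ∀ (i : Fin 6) x, P 0 (bxor x ((Matrix.vecCons (u 1) (Matrix.vecCons (u 2) a) :
      Fin 6 → Fin (7 + 7) → Bool) i)) = P 0 x := by
    intro i x
    refine Fin.cases ?_ (fun i => ?_) i
    · simp only [Matrix.cons_val_zero]; exact hPu' 0 1 x (by decide)
    · simp only [Matrix.cons_val_succ]
      refine Fin.cases ?_ (fun i => ?_) i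
      · simp only [Matrix.cons_val_zero]; exact hPu' 0 2 x (by decide)
      · simp only [Matrix.cons_val_succ]; exact ha i 0 x
  have h7 := h32 q (Matrix.vecCons (u 0) (Matrix.vecCons (u 1) (Matrix.vecCons (u 2) a)))
  rw [hpeel 0 _ hc0, hpeel 1 _ hc1, hpeel 2 a (fun i x => ha i 2 x)] at h7
  -- on the 4-flat every point lies in `U`
  have hU : ∀ ε : Fin 4 → Bool, ∀ j, P j (fun l => q l ^^ decide (Odd #(univ.filter fun i => ε i && a i l))) = true := by
    intro ε j
    set V₀ := univ.filter (fun t : Fin (7 + 7) → Bool => ∀ x, P j (bxor x t) = P j x) with hV₀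
    have h0 : zeroVec ∈ V₀ := mem_filter.2 ⟨mem_univ _, fun x => by rw [bxor_zeroVec]⟩
    exact fo_mem_flatPt V₀ h0 (fun x => P j x = true) (fun x hx t ht => by rw [(mem_filter.1 ht).2 x]; exact hx)
      (hq j) a (fun i => mem_filter.2 ⟨mem_univ _, ha i j⟩) ε
  rw [sum_congr rfl fun ε _ => hτS _ (hU ε)] at h7
  have e : ∑ ε : Fin 4 → Bool,
      (if ((A 0 (fun l => q l ^^ decide (Odd #(univ.filter fun i => ε i && a i l))) &&
            A 1 (fun l => q l ^^ decide (Odd #(univ.filter fun i => ε i && a i l)))) ^^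
           (A 2 (fun l => q l ^^ decide (Odd #(univ.filter fun i => ε i && a i l))) &&
            A 3 (fun l => q l ^^ decide (Odd #(univ.filter fun i => ε i && a i l))))) = true
        then -8 * sZ (f (fun l => q l ^^ decide (Odd #(univ.filter fun i => ε i && a i l)))) else 0) =
      -8 * ∑ ε : Fin 4 → Bool,
      (if ((A 0 (fun l => q l ^^ decide (Odd #(univ.filter fun i => ε i && a i l))) &&
            A 1 (fun l => q l ^^ decide (Odd #(univ.filter fun i => ε i && a i l)))) ^^
           (A 2 (fun l => q l ^^ decide (Odd #(univ.filter fun i => ε i && a i l))) &&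
            A 3 (fun l => q l ^^ decide (Odd #(univ.filter fun i => ε i && a i l))))) = true
        then sZ (f (fun l => q l ^^ decide (Odd #(univ.filter fun i => ε i && a i l)))) else 0) := by
    rw [mul_sum]
    refine sum_congr rfl fun ε _ => ?_
    split_ifs <;> ring
  rw [e, show (32 : ℤ) = -8 * -4 by norm_num] at h7
  have h4 := (mul_dvd_mul_iff_left (by norm_num : (-8 : ℤ) ≠ 0)).1 h7
  rwa [neg_dvd] at h4

end Summit.QuantumAdvantage.QuantumAdvantage.Theorems.CubicForrelation.NearExactIsExact

end
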